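import Literature.NumberTheory.LFunctions.AutomaticSequenceTransducerArith5
import HarnessLib

/-!
# Arithmetic restrictions for the naturally induced transducer, VI: the homomorphism `s₀` on the loop group (Müllner 2017, Prop. 2.23 / Cor. 2.24 at the base state; proved)

Everything in this file is PROVED (plus one plain definition). Continuing §2.4 of C. Müllner,
*Automatic sequences fulfill the Sarnak conjecture* (Duke Math. J. 166 (2017)): with the common
slope `a` of Lemma 2.21 (`exists_common_slope`) define, for a state `M` and a large fixed `ℓ*`,
`s₀(g) := s^{MM}(g, ℓ* d) − ℓ* • a ∈ ZMod d'`. Then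

* `sVal_loop_eq_s0_add` — `s^{MM}(g, ℓd) = s₀(g) + ℓ • a` for every `g ∈ G_M` and `ℓ ≥ ℓ*`
  (additivity with identity loops, Lemma 2.20);
* `s0_trans` — `s₀(g₁ ≫ g₂) = s₀(g₁) + s₀(g₂)` on `G_M` (Lemma 2.20), `s0_one` — `s₀(id) = 0`:
  `s₀` is a homomorphism `G_M → (ZMod d', +)`; its kernel is Müllner's `G₀` (Cor. 2.24) and
  `g ↦ e(ℓ s₀(g)/d')` are the characters `D_ℓ` of §3.2/§4.1 — here for loops at one state;
* `natCast_wordVal_loop` — for a digit loop `w` at `M` with `|w| = ℓd`, `ℓ ≥ ℓ*`: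
  `[w]_k ≡ s₀(T(M,w)) + ℓ • a (mod d')` (so on lengths divisible by `d k₀`, `[w]_k ≡ s₀(T(M,w))`:
  Thm. 2.16 (1) at a state).

The extension to paths between different states (Prop. 2.23 in full, via the second relabelling of
Lemma 2.22) is not formalised here.

## References
* C. Müllner, Duke Math. J. 166 (2017), §2.4: Lemma 2.20, Prop. 2.23, Cor. 2.24, Thm. 2.16. [Mullner2017]
-/

noncomputable section

open Finset

namespace Literature.NumberTheory.LFunctions

namespace MinImage

variable {σ : Type*} [Fintype σ] [DecidableEq σ] {δ : σ → ℕ → σ} {k : ℕ}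

/-- The data behind `s₀`: a threshold `ℓ*` and the common slope `a` such that (i) `d_{g,ℓ}` is
stabilised for `K ≥ ℓ*` everywhere, (ii) every `g ∈ G_M` is realised by loops of every length
`ℓ d`, `ℓ ≥ ℓ*`, at every state, (iii) `s^{MM}(id, ℓd) = ℓ • a` for `ℓ ≥ ℓ*` at every state.
[folklore] -/
theorem exists_s0_data (hk : 2 ≤ k) (htriv : ∀ q d, k ≤ d → δ q d = q) :
    ∃ L : ℕ, ∃ a : ZMod (transducerDPrime hk δ htriv),
      (∀ (M M' : MinImage δ) (c : ZMod (transducerPeriod k δ)) (g : Equiv.Perm (Fin (minRank δ))),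
        g ∈ M.pathOutputs k M' c → ∀ K : ℕ, L ≤ K →
          M.diffGcd k M' g (c.val + K * transducerPeriod k δ) = M.limitDiffGcd hk htriv M' c) ∧
      (∀ (M : MinImage δ) (n : ℕ), L ≤ n → ∀ g ∈ M.loopGroup (by omega : 0 < k) htriv,
        ∃ w : List ℕ, (∀ d ∈ w, d < k) ∧ w.length = n * transducerPeriod k δ ∧ M.next w = M ∧ M.T w = g) ∧
      (∀ (M : MinImage δ) (ℓ : ℕ), L ≤ ℓ → M.sVal hk htriv M 1 (ℓ * transducerPeriod k δ) = ℓ • a) := by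
  obtain ⟨ms, hms⟩ := exists_uniform_stab hk htriv (δ := δ)
  choose mr hmr using fun M : MinImage δ => M.exists_forall_exists_loop_eq (by omega : 0 < k) htriv
  obtain ⟨m, a, hma⟩ := exists_common_slope hk htriv (δ := δ)
  refine ⟨max (max ms (univ.sup mr)) m, a, fun M M' c g hg K hK => hms M M' c g hg K ?_,
    fun M n hn g hg => hmr M n ?_ g hg, fun M ℓ hℓ => hma M ℓ (le_of_max_le_right hℓ)⟩
  · exact (le_max_left _ _).trans ((le_max_left _ _).trans hK)
  · exact ((le_sup (f := mr) (mem_univ M)).trans (le_max_right _ _)).trans ((le_max_left _ _).trans hn)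

/-- The threshold `ℓ*`. [folklore] -/
def s0Level (hk : 2 ≤ k) (htriv : ∀ q d, k ≤ d → δ q d = q) : ℕ :=
  (exists_s0_data hk htriv (δ := δ)).choose

/-- The common slope `a` of Lemma 2.21. [cite: Mullner2017, Lemma 2.21] -/
def s0Slope (hk : 2 ≤ k) (htriv : ∀ q d, k ≤ d → δ q d = q) : ZMod (transducerDPrime hk δ htriv) :=
  (exists_s0_data hk htriv (δ := δ)).choose_spec.choose

/-- The specification of `s0Level`/`s0Slope`. [folklore] -/
theorem s0_spec (hk : 2 ≤ k) (htriv : ∀ q d, k ≤ d → δ q d = q) :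
    (∀ (M M' : MinImage δ) (c : ZMod (transducerPeriod k δ)) (g : Equiv.Perm (Fin (minRank δ))),
        g ∈ M.pathOutputs k M' c → ∀ K : ℕ, s0Level hk htriv (δ := δ) ≤ K →
          M.diffGcd k M' g (c.val + K * transducerPeriod k δ) = M.limitDiffGcd hk htriv M' c) ∧
      (∀ (M : MinImage δ) (n : ℕ), s0Level hk htriv (δ := δ) ≤ n → ∀ g ∈ M.loopGroup (by omega : 0 < k) htriv,
        ∃ w : List ℕ, (∀ d ∈ w, d < k) ∧ w.length = n * transducerPeriod k δ ∧ M.next w = M ∧ M.T w = g) ∧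
      (∀ (M : MinImage δ) (ℓ : ℕ), s0Level hk htriv (δ := δ) ≤ ℓ →
        M.sVal hk htriv M 1 (ℓ * transducerPeriod k δ) = ℓ • s0Slope hk htriv) :=
  (exists_s0_data hk htriv (δ := δ)).choose_spec.choose_spec

/-- **`s₀` on the loop group** (Müllner's `s₀`, Prop. 2.23, at a state): `s₀(g) = s^{MM}(g, ℓ* d) − ℓ* • a`.
[cite: Mullner2017, Prop. 2.23] -/
def s0 (hk : 2 ≤ k) (htriv : ∀ q d, k ≤ d → δ q d = q) (M : MinImage δ)
    (g : Equiv.Perm (Fin (minRank δ))) : ZMod (transducerDPrime hk δ htriv) :=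
  M.sVal hk htriv M g (s0Level hk htriv (δ := δ) * transducerPeriod k δ) -
    s0Level hk htriv (δ := δ) • s0Slope hk htriv

/-- **Additivity with identity loops**: `s^{MM}(g, (ℓ+ℓ')d) = s^{MM}(g, ℓd) + ℓ' • a` for `g ∈ G_M`,
`ℓ, ℓ' ≥ ℓ*`. [cite: Mullner2017, Lemma 2.20] -/
theorem sVal_loop_add (hk : 2 ≤ k) (htriv : ∀ q d, k ≤ d → δ q d = q) (M : MinImage δ)
    {g : Equiv.Perm (Fin (minRank δ))} (hg : g ∈ M.loopGroup (by omega : 0 < k) htriv) {ℓ ℓ' : ℕ}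
    (hℓ : s0Level hk htriv (δ := δ) ≤ ℓ) (hℓ' : s0Level hk htriv (δ := δ) ≤ ℓ') :
    M.sVal hk htriv M g ((ℓ + ℓ') * transducerPeriod k δ) =
      M.sVal hk htriv M g (ℓ * transducerPeriod k δ) + ℓ' • s0Slope hk htriv := by
  haveI : NeZero (transducerPeriod k δ) := ⟨(transducerPeriod_pos (by omega) htriv).ne'⟩
  obtain ⟨hstab, hreal, hslope⟩ := s0_spec hk htriv (δ := δ)
  have hg0 : g ∈ M.pathOutputs k M 0 := mem_loopGroup.1 hg
  have h1 : (1 : Equiv.Perm (Fin (minRank δ))) ∈ M.pathOutputs k M 0 :=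
    mem_pathOutputs.2 ⟨[], by simp, by simp, M.next_nil, M.T_nil⟩
  have hg1 : g.trans (1 : Equiv.Perm (Fin (minRank δ))) = g := by rw [Equiv.Perm.one_def, Equiv.trans_refl]
  obtain ⟨w, hwd, hwl, hwn, hwT⟩ := hreal M ℓ hℓ g hg
  obtain ⟨w', hw'd, hw'l, hw'n, hw'T⟩ := hreal M ℓ' hℓ' 1 (Subgroup.one_mem _)
  have hs₁ := hstab M M 0 g hg0 ℓ hℓ
  have hs₂ := hstab M M 0 1 h1 ℓ' hℓ'
  have hs := hstab M M 0 (g.trans 1) (by rw [hg1]; exact hg0) (ℓ + ℓ') (hℓ.trans (Nat.le_add_right _ _))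
  have key := sVal_add hk htriv (c₁ := (0 : ZMod (transducerPeriod k δ))) hs₁ hs₂ hs hwd
    (by rw [hwl, ZMod.val_zero, zero_add]) hwn hwT hw'd hw'l hw'n hw'T
  rw [hg1] at key
  simp only [ZMod.val_zero, zero_add] at key
  rw [key, hslope M ℓ' hℓ']

/-- **`s^{MM}(g, ℓd) = s₀(g) + ℓ • a`** for `g ∈ G_M`, `ℓ ≥ ℓ*`. [cite: Mullner2017, Prop. 2.23] -/
theorem sVal_loop_eq_s0_add (hk : 2 ≤ k) (htriv : ∀ q d, k ≤ d → δ q d = q) (M : MinImage δ)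
    {g : Equiv.Perm (Fin (minRank δ))} (hg : g ∈ M.loopGroup (by omega : 0 < k) htriv) {ℓ : ℕ}
    (hℓ : s0Level hk htriv (δ := δ) ≤ ℓ) :
    M.sVal hk htriv M g (ℓ * transducerPeriod k δ) = M.s0 hk htriv g + ℓ • s0Slope hk htriv := by
  -- compare both with the length `(ℓ* + ℓ) d`
  have e1 := M.sVal_loop_add hk htriv hg (le_refl (s0Level hk htriv (δ := δ))) hℓ
  have e2 := M.sVal_loop_add hk htriv hg hℓ (le_refl (s0Level hk htriv (δ := δ)))
  rw [Nat.add_comm ℓ (s0Level hk htriv (δ := δ))] at e2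
  rw [s0]
  simp only [nsmul_eq_mul] at e1 e2 ⊢
  linear_combination e1 - e2

/-- **`s₀(id) = 0`**. [cite: Mullner2017, Cor. 2.24] -/
theorem s0_one (hk : 2 ≤ k) (htriv : ∀ q d, k ≤ d → δ q d = q) (M : MinImage δ) :
    M.s0 hk htriv 1 = 0 := by
  rw [s0, (s0_spec hk htriv (δ := δ)).2.2 M _ le_rfl, sub_self]

/-- **`s₀` is a homomorphism on `G_M`** (Lemma 2.20): `s₀(g₁ ≫ g₂) = s₀(g₁) + s₀(g₂)`; its kernel
is Müllner's `G₀` (Cor. 2.24). [cite: Mullner2017, Cor. 2.24] -/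
theorem s0_trans (hk : 2 ≤ k) (htriv : ∀ q d, k ≤ d → δ q d = q) (M : MinImage δ)
    {g₁ g₂ : Equiv.Perm (Fin (minRank δ))} (h₁ : g₁ ∈ M.loopGroup (by omega : 0 < k) htriv)
    (h₂ : g₂ ∈ M.loopGroup (by omega : 0 < k) htriv) :
    M.s0 hk htriv (g₁.trans g₂) = M.s0 hk htriv g₁ + M.s0 hk htriv g₂ := by
  haveI : NeZero (transducerPeriod k δ) := ⟨(transducerPeriod_pos (by omega) htriv).ne'⟩
  obtain ⟨hstab, hreal, -⟩ := s0_spec hk htriv (δ := δ)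
  set L := s0Level hk htriv (δ := δ) with hL
  have h12 : g₁.trans g₂ ∈ M.loopGroup (by omega : 0 < k) htriv := by
    have := Subgroup.mul_mem _ h₂ h₁
    rwa [Equiv.Perm.mul_def] at this
  obtain ⟨w₁, h₁d, h₁l, h₁n, h₁T⟩ := hreal M L le_rfl g₁ h₁
  obtain ⟨w₂, h₂d, h₂l, h₂n, h₂T⟩ := hreal M L le_rfl g₂ h₂
  have hs₁ := hstab M M 0 g₁ (mem_loopGroup.1 h₁) L le_rfl
  have hs₂ := hstab M M 0 g₂ (mem_loopGroup.1 h₂) L le_rfl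
  have hs := hstab M M 0 (g₁.trans g₂) (mem_loopGroup.1 h12) (L + L) (Nat.le_add_right _ _)
  have key := sVal_add hk htriv (c₁ := (0 : ZMod (transducerPeriod k δ))) hs₁ hs₂ hs h₁d
    (by rw [h₁l, ZMod.val_zero, zero_add]) h₁n h₁T h₂d h₂l h₂n h₂T
  simp only [ZMod.val_zero, zero_add] at key
  -- `s(g₁g₂, 2Ld) = s₀(g₁g₂) + 2L•a`, `s(gᵢ, Ld) = s₀(gᵢ) + L•a`
  rw [M.sVal_loop_eq_s0_add hk htriv h12 (Nat.le_add_right _ _), M.sVal_loop_eq_s0_add hk htriv h₁ le_rfl,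
    M.sVal_loop_eq_s0_add hk htriv h₂ le_rfl] at key
  simp only [nsmul_eq_mul, Nat.cast_add] at key ⊢
  linear_combination key

/-- **Thm. 2.16 (1) at a state, residues**: for a digit loop `w` at `M` of length `ℓ d` with
`ℓ ≥ ℓ*`, `[w]_k ≡ s₀(T(M, w)) + ℓ • a (mod d')`; in particular `[w]_k ≡ s₀(T(M,w))` when
`k₀ ∣ ℓ`. [cite: Mullner2017, Thm. 2.16] -/
theorem natCast_wordVal_loop (hk : 2 ≤ k) (htriv : ∀ q d, k ≤ d → δ q d = q) (M : MinImage δ)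
    {w : List ℕ} (hwd : ∀ d ∈ w, d < k) {ℓ : ℕ} (hwl : w.length = ℓ * transducerPeriod k δ)
    (hwn : M.next w = M) (hℓ : s0Level hk htriv (δ := δ) ≤ ℓ) :
    ((wordVal k w : ℕ) : ZMod (transducerDPrime hk δ htriv)) =
      M.s0 hk htriv (M.T w) + ℓ • s0Slope hk htriv := by
  haveI : NeZero (transducerPeriod k δ) := ⟨(transducerPeriod_pos (by omega) htriv).ne'⟩
  have hg : M.T w ∈ M.loopGroup (by omega : 0 < k) htriv :=
    T_mem_loopGroup hwd hwn (by rw [hwl]; exact dvd_mul_left _ _)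
  have hstab := (s0_spec hk htriv (δ := δ)).1 M M 0 (M.T w) (mem_loopGroup.1 hg) ℓ hℓ
  rw [← M.sVal_loop_eq_s0_add hk htriv hg hℓ]
  have := sVal_eq hk htriv hstab hwd (by rw [hwl, ZMod.val_zero, zero_add]) hwn rfl
  rw [ZMod.val_zero, zero_add] at this
  exact this.symm

end MinImage

end Literature.NumberTheory.LFunctions
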